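import Summits.QuantumAdvantage.QuantumAdvantage.Theorems.NearExactIsExact.Negative.KThreeInvolution

/-!
# `NearExactIsExact` (stmt-QuantumAdvantage-14043) — negative lemma: THEOREM K3-COMM
  (commutative unipotent pencils with an odd relation are EMPTY; gen 45 disprover)

Setting of `KThreeInvolution`: `π(ū,s) = (ū, p(ū) ⊕ K(ū)s)` over a 3-bit base, `K(ū)` additive, `K(0̄) = id`,
`p` arbitrary, residual `[ū = 0̄]·V(s)`.  `kthree_chain` says: under a cubic pair, every CLOSED WALK
`τ_{k+1} = K(w_k)τ_k` (letters `w_k ≠ 0̄`) of direction triples has even `T_V`-mass.  Here the fibre maps are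
assumed to COMMUTE (`K(ū)K(v̄) = K(v̄)K(ū)`), to satisfy `K(ū)^{7q+1} = id` (e.g. `q = 1`: `K(ū)⁸ = id`,
every unipotent pencil on a fibre of dimension `≤ 8`, i.e. BQ-11; `q = 9`: `K(ū)⁶⁴ = id`) and ONE odd relation
`K(w₆)⋯K(w₀) = id` with non-zero letters (e.g. `Π_{ū≠0̄} K(ū) = id`).  Closed-walk parity alone then gives:
* `kc_swap`     — `T(K(ū)t) = T(K(v̄)t)` for all triples `t` and `ū, v̄ ≠ 0̄` (the walks `(ū,v̄)+R` and
  `(v̄,ū)+R` with the common return word `R = v̄^{7q} ū^{7q}` agree from step 2 on);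
* `kc_class`    — along any walk with non-zero letters, `T(τ_j) = T(K(ū)^j τ₀)`;
* `kc_inv`      — `T(K(ū)t) = T(t)` (`j ↦ T(K(ū)^j t)` has periods `7` and `7q+1`);
* `kthree_comm_empty` — THEOREM K3-COMM: no cubic pair has residual `[ū = 0̄]·V(s)` when `V` is odd on
  some 3-space (every codimension-3 flat): the walk along the odd relation weighs `7·T(a) = 1`.
One-sided (only `π`), every fibre dimension, every section `p`, census-free.  Covers every two-sided
(inversion-affine) K3 pencil met in the gen-45 census except those without an odd positive relation.

HONEST FRAMING: a kernel-checked negative lemma on the thin algebraic end of the `naff = 3` stratum of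
BQ-11; NOT summit progress.
-/

set_option linter.dupNamespace false -- D-0017: single-problem summit ⇒ `QuantumAdvantage.QuantumAdvantage` by design

namespace Summit.QuantumAdvantage.QuantumAdvantage.Theorems.NearExactIsExact.Negative.KThreeCommutative

open Finset
open Literature.Computability.QuantumComplexity
open Literature.Computability.QuantumComplexity.BuzetChailloux (bxor)
open Summit.QuantumAdvantage.QuantumAdvantage.Theorems.NearExactIsExact.Negative.SkewProductCore (ind)
open Summit.QuantumAdvantage.QuantumAdvantage.Theorems.NearExactIsExact.Negative.KThreeInvolution
  (kthree_chain)

variable {m : ℕ}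

/-- **Swap lemma.** If every closed walk with non-zero letters has even `T`-mass, the fibre maps commute
and `K(ū)^{7q+1} = id`, then `T(K(ū)t) = T(K(v̄)t)` for all non-zero `ū, v̄` and all triples `t`: the
walks `ū, v̄, v̄^{7q}, ū^{7q}` and `v̄, ū, v̄^{7q}, ū^{7q}` from `t` are closed, coincide from step 2 on,
and their masses differ by `T(K(ū)t) + T(K(v̄)t)`. [folklore] -/
theorem kc_swap (K : (Fin 3 → Bool) → (Fin m → Bool) → (Fin m → Bool))
    (T : (Fin 3 → Fin m → Bool) → ZMod 2)
    (hwalk : ∀ (L : ℕ) (w : ℕ → Fin 3 → Bool) (τ : ℕ → Fin 3 → Fin m → Bool),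
      (∀ k, k ≤ L → w k ≠ fun _ => false) → (∀ k, k ≤ L → τ (k + 1) = fun i => K (w k) (τ k i)) →
      τ (L + 1) = τ 0 → ∑ j : Fin (L + 1), T (τ j) = 0)
    (hcomm : ∀ u v s, K u (K v s) = K v (K u s)) (q : ℕ) (hq : ∀ u s, (K u)^[7 * q + 1] s = s)
    (u v : Fin 3 → Bool) (hu : u ≠ fun _ => false) (hv : v ≠ fun _ => false)
    (t : Fin 3 → Fin m → Bool) :
    T (fun i => K u (t i)) = T (fun i => K v (t i)) := by
  -- the two words
  obtain ⟨a, ha0, ha1, ha2⟩ : ∃ a : ℕ → Fin 3 → Bool, a 0 = u ∧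
      (∀ k, 1 ≤ k → k ≤ 7 * q + 1 → a k = v) ∧ (∀ k, 7 * q + 2 ≤ k → a k = u) :=
    ⟨fun k => if k = 0 then u else if k ≤ 7 * q + 1 then v else u, by simp,
      fun k hk1 hk2 => by simp [show k ≠ 0 by omega, hk2],
      fun k hk => by simp [show k ≠ 0 by omega, show ¬ k ≤ 7 * q + 1 by omega]⟩
  obtain ⟨b, hb0, hb1, hb2, hb3⟩ : ∃ b : ℕ → Fin 3 → Bool, b 0 = v ∧ b 1 = u ∧
      (∀ k, 2 ≤ k → k ≤ 7 * q + 1 → b k = v) ∧ (∀ k, 7 * q + 2 ≤ k → b k = u) :=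
    ⟨fun k => if k = 0 then v else if k = 1 then u else if k ≤ 7 * q + 1 then v else u, by simp,
      by simp, fun k hk1 hk2 => by simp [show k ≠ 0 by omega, show k ≠ 1 by omega, hk2],
      fun k hk => by simp [show k ≠ 0 by omega, show k ≠ 1 by omega, show ¬ k ≤ 7 * q + 1 by omega]⟩
  -- the two walks
  obtain ⟨τA, hA0, hAs⟩ : ∃ τ : ℕ → Fin 3 → Fin m → Bool, τ 0 = t ∧
      ∀ k, τ (k + 1) = fun i => K (a k) (τ k i) :=
    ⟨fun k => Nat.rec (motive := fun _ => Fin 3 → Fin m → Bool) t (fun k s i => K (a k) (s i)) k,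
      rfl, fun _ => rfl⟩
  obtain ⟨τB, hB0, hBs⟩ : ∃ τ : ℕ → Fin 3 → Fin m → Bool, τ 0 = t ∧
      ∀ k, τ (k + 1) = fun i => K (b k) (τ k i) :=
    ⟨fun k => Nat.rec (motive := fun _ => Fin 3 → Fin m → Bool) t (fun k s i => K (b k) (s i)) k,
      rfl, fun _ => rfl⟩
  -- walk A: positions 1 .. 7q+2
  have hA1 : ∀ i, i ≤ 7 * q + 1 → τA (i + 1) = fun j => (K v)^[i] (K u (t j)) := by
    intro i
    induction i with
    | zero => intro _; rw [hAs, ha0, hA0]; rfl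
    | succ i ih =>
      intro hi
      rw [hAs, ih (Nat.le_of_succ_le hi), ha1 (i + 1) (Nat.succ_le_succ (Nat.zero_le i)) hi]
      funext j
      rw [Function.iterate_succ_apply']
  have hA2 : τA (7 * q + 2) = fun j => K u (t j) := by
    rw [hA1 (7 * q + 1) le_rfl]
    funext j
    rw [hq]
  -- walk A: positions 7q+2 .. 14q+2
  have hA3 : ∀ i, τA (7 * q + 2 + i) = fun j => (K u)^[i] (K u (t j)) := by
    intro i
    induction i with
    | zero => rw [Nat.add_zero, hA2]; rfl
    | succ i ih =>
      rw [← Nat.add_assoc, hAs, ih, ha2 (7 * q + 2 + i) (Nat.le_add_right _ _)]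
      funext j
      rw [Function.iterate_succ_apply']
  have hA4 : τA (14 * q + 1 + 1) = t := by
    rw [show 14 * q + 1 + 1 = 7 * q + 2 + 7 * q by ring, hA3]
    funext j
    rw [← Function.iterate_succ_apply, hq]
  -- walk B coincides with walk A from position 2 on
  have hB1 : τB 1 = fun j => K v (t j) := by
    rw [show (1 : ℕ) = 0 + 1 from rfl, hBs, hb0, hB0]
  have hAB : ∀ i, τB (i + 1 + 1) = τA (i + 1 + 1) := by
    intro i
    induction i with
    | zero =>
      rw [hBs, hB1, hb1, hA1 1 (by omega)]
      funext j
      rw [Function.iterate_one, hcomm]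
    | succ i ih =>
      rw [hBs (i + 1 + 1), hAs (i + 1 + 1), ih]
      by_cases hi : i + 1 + 1 ≤ 7 * q + 1
      · rw [hb2 _ (by omega) hi, ha1 _ (by omega) hi]
      · rw [hb3 _ (by omega), ha2 _ (by omega)]
  have hB4 : τB (14 * q + 1 + 1) = t := (hAB (14 * q)).trans hA4
  -- letters are non-zero
  have hane : ∀ k, k ≤ 14 * q + 1 → a k ≠ fun _ => false := by
    intro k _
    rcases Nat.eq_zero_or_pos k with rfl | hk
    · rw [ha0]; exact hu
    by_cases hk2 : k ≤ 7 * q + 1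
    · rw [ha1 k hk hk2]; exact hv
    · rw [ha2 k (by omega)]; exact hu
  have hbne : ∀ k, k ≤ 14 * q + 1 → b k ≠ fun _ => false := by
    intro k _
    rcases Nat.eq_zero_or_pos k with rfl | hk
    · rw [hb0]; exact hv
    by_cases hk1 : k = 1
    · rw [hk1, hb1]; exact hu
    by_cases hk2 : k ≤ 7 * q + 1
    · rw [hb2 k (by omega) hk2]; exact hv
    · rw [hb3 k (by omega)]; exact hu
  -- the two parities
  have SA := hwalk (14 * q + 1) a τA hane (fun k _ => hAs k) (hA4.trans hA0.symm)
  have SB := hwalk (14 * q + 1) b τB hbne (fun k _ => hBs k) (hB4.trans hB0.symm)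
  rw [Fin.sum_univ_eq_sum_range (fun j => T (τA j)), sum_range_succ', sum_range_succ'] at SA
  rw [Fin.sum_univ_eq_sum_range (fun j => T (τB j)), sum_range_succ', sum_range_succ'] at SB
  simp only [hAB] at SB
  rw [hB0, hB1] at SB
  rw [hA0, show τA (0 + 1) = fun j => K u (t j) by rw [hA1 0 (Nat.zero_le _)]; rfl] at SA
  linear_combination SA - SB

/-- **Class lemma.** Under the hypotheses of `kc_swap`: along any walk `σ_{k+1} = K(w_k)σ_k` whose first
`j` letters are non-zero, `T(σ_j) = T(K(ū)^j σ₀)` for every non-zero `ū` (swap the letters one at a time,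
commuting `K(ū)` through the word). [folklore] -/
theorem kc_class (K : (Fin 3 → Bool) → (Fin m → Bool) → (Fin m → Bool))
    (T : (Fin 3 → Fin m → Bool) → ZMod 2)
    (hwalk : ∀ (L : ℕ) (w : ℕ → Fin 3 → Bool) (τ : ℕ → Fin 3 → Fin m → Bool),
      (∀ k, k ≤ L → w k ≠ fun _ => false) → (∀ k, k ≤ L → τ (k + 1) = fun i => K (w k) (τ k i)) →
      τ (L + 1) = τ 0 → ∑ j : Fin (L + 1), T (τ j) = 0)
    (hcomm : ∀ u v s, K u (K v s) = K v (K u s)) (q : ℕ) (hq : ∀ u s, (K u)^[7 * q + 1] s = s)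
    (u : Fin 3 → Bool) (hu : u ≠ fun _ => false) (w : ℕ → Fin 3 → Bool) (j : ℕ)
    (hw : ∀ k, k < j → w k ≠ fun _ => false) (s : Fin 3 → Fin m → Bool)
    (σ : ℕ → Fin 3 → Fin m → Bool) (hσ0 : σ 0 = s) (hσ : ∀ k, σ (k + 1) = fun i => K (w k) (σ k i)) :
    T (σ j) = T (fun i => (K u)^[j] (s i)) := by
  induction j generalizing s σ with
  | zero => rw [hσ0]; rfl
  | succ j ih =>
    rw [hσ j, kc_swap K T hwalk hcomm q hq (w j) u (hw j (Nat.lt_succ_self j)) hu (σ j)]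
    -- `K(ū) ∘ σ` is the walk from `K(ū) ∘ s` along the same word
    have h := ih (fun k hk => hw k (Nat.lt_succ_of_lt hk)) (fun i => K u (s i))
      (fun k i => K u (σ k i)) (by rw [hσ0]) (fun k => by
        funext i
        rw [hσ k, hcomm])
    rw [h]
    rfl

/-- **Invariance.** Under the hypotheses of `kc_swap` plus one odd relation `K(w₆)⋯K(w₀) = id` with
non-zero letters: `T(K(ū)t) = T(t)` for every non-zero `ū` — `j ↦ T(K(ū)^j t)` has period `7` (class
lemma along the relation) and period `7q+1`. [folklore] -/
theorem kc_inv (K : (Fin 3 → Bool) → (Fin m → Bool) → (Fin m → Bool))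
    (T : (Fin 3 → Fin m → Bool) → ZMod 2)
    (hwalk : ∀ (L : ℕ) (w : ℕ → Fin 3 → Bool) (τ : ℕ → Fin 3 → Fin m → Bool),
      (∀ k, k ≤ L → w k ≠ fun _ => false) → (∀ k, k ≤ L → τ (k + 1) = fun i => K (w k) (τ k i)) →
      τ (L + 1) = τ 0 → ∑ j : Fin (L + 1), T (τ j) = 0)
    (hcomm : ∀ u v s, K u (K v s) = K v (K u s)) (q : ℕ) (hq : ∀ u s, (K u)^[7 * q + 1] s = s)
    (w : ℕ → Fin 3 → Bool) (hw : ∀ k, k ≤ 6 → w k ≠ fun _ => false)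
    (hprod : ∀ s, K (w 6) (K (w 5) (K (w 4) (K (w 3) (K (w 2) (K (w 1) (K (w 0) s)))))) = s)
    (u : Fin 3 → Bool) (hu : u ≠ fun _ => false) (t : Fin 3 → Fin m → Bool) :
    T (fun i => K u (t i)) = T t := by
  -- period 7
  have h7 : ∀ j, T (fun i => (K u)^[j + 7] (t i)) = T (fun i => (K u)^[j] (t i)) := by
    intro j
    have hc := kc_class K T hwalk hcomm q hq u hu w 7 (fun k hk => hw k (Nat.le_of_lt_succ hk))
      (fun i => (K u)^[j] (t i))
      (fun k => Nat.rec (motive := fun _ => Fin 3 → Fin m → Bool) (fun i => (K u)^[j] (t i))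
        (fun k s i => K (w k) (s i)) k) rfl (fun _ => rfl)
    have hrel : (Nat.rec (motive := fun _ => Fin 3 → Fin m → Bool) (fun i => (K u)^[j] (t i))
        (fun k s i => K (w k) (s i)) 7 : Fin 3 → Fin m → Bool) = fun i => (K u)^[j] (t i) :=
      funext fun i => hprod _
    rw [hrel] at hc
    rw [hc]
    congr 1
    funext i
    rw [Nat.add_comm, Function.iterate_add_apply]
  have h7q : ∀ n j, T (fun i => (K u)^[j + 7 * n] (t i)) = T (fun i => (K u)^[j] (t i)) := by
    intro n
    induction n with
    | zero => intro j; rfl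
    | succ n ih =>
      intro j
      rw [show j + 7 * (n + 1) = (j + 7 * n) + 7 by ring, h7, ih]
  -- period 7q+1
  have hR : ∀ j, T (fun i => (K u)^[j + (7 * q + 1)] (t i)) = T (fun i => (K u)^[j] (t i)) := by
    intro j
    congr 1
    funext i
    rw [Function.iterate_add_apply, hq]
  have h := hR 0
  rw [show 0 + (7 * q + 1) = 1 + 7 * q by ring, h7q] at h
  simpa using h

/-- **THEOREM K3-COMM.** `K(ū)` additive with `K(0̄) = id`, pairwise COMMUTING, `K(ū)^{7q+1} = id` for
some `q` (unipotent pencils: `q = 1` for fibre dimension `≤ 8`, `q = 9` for `≤ 64`), and one odd relation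
`K(w₆)⋯K(w₀) = id` with non-zero letters (e.g. `Π_{ū≠0̄}K(ū) = id`); `π(ū,s) = (ū, p(ū) ⊕ K(ū)s)` for
ANY `p`; residual `[ū = 0̄]·V(s)` with `V` odd on some 3-space (every codimension-3 flat).  Then no cubic
pair `c₁ ⊕ c₂∘π` has that residual: by `kc_inv` `T_V` is invariant, so the closed walk along the odd
relation from `a` weighs `7·T_V(a) = 1`, contradicting `kthree_chain`. [folklore] -/
theorem kthree_comm_empty (K : (Fin 3 → Bool) → (Fin m → Bool) → (Fin m → Bool))
    (hKadd : ∀ u s t, K u (bxor s t) = bxor (K u s) (K u t)) (hK0 : ∀ s, K (fun _ => false) s = s)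
    (hcomm : ∀ u v s, K u (K v s) = K v (K u s)) (q : ℕ) (hq : ∀ u s, (K u)^[7 * q + 1] s = s)
    (w : ℕ → (Fin 3 → Bool)) (hw : ∀ k, k ≤ 6 → w k ≠ fun _ => false)
    (hprod : ∀ s, K (w 6) (K (w 5) (K (w 4) (K (w 3) (K (w 2) (K (w 1) (K (w 0) s)))))) = s)
    (p : (Fin 3 → Bool) → (Fin m → Bool)) (π : (Fin (3 + m) → Bool) → (Fin (3 + m) → Bool))
    (hπ : ∀ u s, π (Fin.append u s) = Fin.append u (bxor (p u) (K u s)))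
    (V : (Fin m → Bool) → Bool)
    (hV : ∃ a : Fin 3 → Fin m → Bool,
      ∑ ε : Fin 3 → Bool, ind (V fun l => decide (Odd #(univ.filter fun i => ε i && a i l))) = 1)
    (c₁ c₂ : (Fin (3 + m) → Bool) → Bool) (h₁ : IsDegLeFun 3 c₁) (h₂ : IsDegLeFun 3 c₂)
    (hres : ∀ z, (c₁ z ^^ c₂ (π z)) =
      (decide (∀ i : Fin 3, z (Fin.castAdd m i) = false) && V (fun k => z (Fin.natAdd 3 k)))) :
    False := by
  have hwalk : ∀ (L : ℕ) (w : ℕ → Fin 3 → Bool) (τ : ℕ → Fin 3 → Fin m → Bool),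
      (∀ k, k ≤ L → w k ≠ fun _ => false) → (∀ k, k ≤ L → τ (k + 1) = fun i => K (w k) (τ k i)) →
      τ (L + 1) = τ 0 → ∑ j : Fin (L + 1), (fun t : Fin 3 → Fin m → Bool => ∑ ε : Fin 3 → Bool,
        ind (V fun l => decide (Odd #(univ.filter fun i => ε i && t i l)))) (τ j) = 0 :=
    fun L w τ hw hτ hL => kthree_chain K hKadd hK0 p π hπ V c₁ c₂ h₁ h₂ hres L w hw τ hτ hL
  have hinv : ∀ (u : Fin 3 → Bool) (a : Fin 3 → Fin m → Bool),
      ∑ ε : Fin 3 → Bool, ind (V fun l => decide (Odd #(univ.filter fun i => ε i && K u (a i) l))) =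
        ∑ ε : Fin 3 → Bool, ind (V fun l => decide (Odd #(univ.filter fun i => ε i && a i l))) := by
    intro u a
    by_cases hu : u = fun _ => false
    · simp only [hu, hK0]
    · exact kc_inv K (fun t : Fin 3 → Fin m → Bool => ∑ ε : Fin 3 → Bool,
        ind (V fun l => decide (Odd #(univ.filter fun i => ε i && t i l)))) hwalk hcomm q hq w hw
        hprod u hu a
  obtain ⟨a, ha⟩ := hV
  have hconst : ∀ k, ∑ ε : Fin 3 → Bool, ind (V fun l => decide (Odd #(univ.filter fun i => ε i &&
      (Nat.rec (motive := fun _ => Fin 3 → Fin m → Bool) a (fun k t i => K (w k) (t i)) k) i l))) = 1 := by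
    intro k
    induction k with
    | zero => exact ha
    | succ k ih => simp only [hinv]; exact ih
  have h := kthree_chain K hKadd hK0 p π hπ V c₁ c₂ h₁ h₂ hres 6 w hw
    (fun k => Nat.rec (motive := fun _ => Fin 3 → Fin m → Bool) a (fun k t i => K (w k) (t i)) k)
    (fun _ _ => rfl) (funext fun i => hprod (a i))
  simp only [hconst, sum_const, card_univ, Fintype.card_fin] at h
  exact absurd h (by decide)

end Summit.QuantumAdvantage.QuantumAdvantage.Theorems.NearExactIsExact.Negative.KThreeCommutative
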